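import Mathlib
import HarnessLib
import Summits.HubbardSuperconductivity.HubbardSuperconductivity.Theorems.KLProgrammeSWaveCascadeEdge
import Summits.HubbardSuperconductivity.HubbardSuperconductivity.Theorems.KLProgrammeSWaveCascadeBridge

/-!
# Route `KLProgramme` — row 0′ (child 1) at MATRIX level, CARRIER-GENERIC: the in-class ladder envelope for ANY scale-indexed family of
# ball-supported matrices with signed right-inverse ladder steps (the Δ21 clause shape of `PairLadderStepAtV8`, no net-mass floor)

Cell gate-hubbard-kl, seat hubbard-kl-k3c1-p2 (child-1 re-closure owner; technique «row-0′ V4/S twin induction measured from its own constant»).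
This is `pairLadder_envelope_edge` (`…SplitPairLadderEdge`, p473596) with the MODEL CARRIER ABSTRACTED — proof adapted from that file: the index
type `S` (there `TorusSite 2 L`), the ball `B` (there `klBall L μ K`), the matrices `C i` (there `klPairArray … i Qm`, whose entries on the ball are the
pair amplitudes `klPairAmplitude … i Qm k k'`), the per-step budget `τ i` (there `drivePBar + eremBar`), the initial deviation `ι₀` (there `initDevBar`)
and the ℓ¹ mass bound `b` (there `G.bhi`) are parameters.  Nothing in the row-0′ argument reads the carrier: it uses only (i) row support of `C i`
off the ball, (ii) the right inverses `(1 + diag w_i · C i)·N_i = 1` turned into implicit steps (`implicit_step_of_rightInverse`), (iii) restriction to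
the ball (`resArr_wmul`), (iv) the scalar cascade `U_{i+1} = U_i/(1 + W_i U_i)` with the negative-mass floor (`sWaveFloor_bounds`) and (v) the signed
cascade envelope `sWaveCascade_envelope_edge`.  PURPOSE (cell STATUS 2026-08-27, p1 g8 E2-STRUCTURE-NOTE 0e503bca3287cbfe options (A)/(B)/(C)): the
same envelope is needed on the WICK-ORDERED pair amplitudes (`KLRegimeWick.klWickPairAmplitude`, p481972) — for the engine's private Wick invariant
under (A)/(C) and for child 1 itself under (B) — and on any future value carrier; each is now a ≈ 40-line instance of this theorem
(`C i :=` the ball-truncated array, `hCsupp :=` its off-ball vanishing).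

**`matrixLadder_envelope_edge`**: `S` finite, `B ⊆ S`, `C : ℕ → Matrix S S ℂ` row-supported on `B`, `0 ≤ U`, steps `i < n` with weights
`w_i : S → ℝ`, `Σ|w_i| ≤ b`, `Σ(|w_i| − w_i) ≤ δ_i`, a right inverse `N_i` of `1 + diag(w_i)·C i` and `‖C (i+1) k k' − (C i · N_i) k k'‖ ≤ τ_i + X_{i+1}(k,k')`
on `B × B`; `‖C 0 k k' − U‖ ≤ ι₀ + X_0(k,k')`; `X ≥ 0` with `X_{i+1} ≤ Xsup` and `X_0 + Σ_{i<n} X_{i+1} ≤ Xtot` entrywise; the negative-mass line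
`16·U·Σ_{i<n} δ_i ≤ 1` and the no-onset smallness `8·42·(A + R)·(b·n) ≤ 1`, `A = ι₀ + Στ + Xtot`, `R = Στ + Xsup` ⟹
`∃ u ∈ [0, (16/15)·U]` with `‖C n k k' − u‖ ≤ 12·(A + R)` on `B × B`; **`amplitudeLadder_envelope_edge`**: the same for an amplitude family
`𝒜 : ℕ → S → S → ℂ` read through its ball-truncated array `Matrix.of (fun s t => if s ∈ B ∧ t ∈ B then 𝒜 i s t else 0)` (the (E2-v8) clause shape;
`pairLadder_envelope_edge` = the instance `𝒜 i := klPairAmplitude … i Qm`).  Everything is proved; no definitions.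
-/

noncomputable section

namespace Summit.HubbardSuperconductivity.HubbardSuperconductivity.Theorems.SWaveCascade

set_option linter.dupNamespace false -- summit = problem name (single-conjunct summit), D-0017

open Finset

variable {S : Type*} [Fintype S] [DecidableEq S]

/-- **Row 0′, in-class ladder part, at matrix level for an arbitrary carrier.**  See the module docstring: ball-supported matrices `C i`,
signed weights with ℓ¹ mass `≤ b` and sign defect `≤ δ_i` (no sign hypothesis on `b`, `δ_i` is needed), right inverses and entrywise step bounds `τ_i + X_{i+1}`, initial deviation
`ι₀ + X_0` from the constant `U ≥ 0`, the negative-mass line and the no-onset smallness ⟹ an envelope constant `u ∈ [0, (16/15)·U]` with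
`‖C n k k' − u‖ ≤ 12·((ι₀ + Στ + Xtot) + (Στ + Xsup))` on the ball. -/
theorem matrixLadder_envelope_edge (B : Finset S) (C : ℕ → Matrix S S ℂ) (hCsupp : ∀ i u, u ∉ B → ∀ t, C i u t = 0)
    {U b ι₀ : ℝ} (hU : 0 ≤ U) (hι₀ : 0 ≤ ι₀) (τ : ℕ → ℝ) (hτ0 : ∀ j, 0 ≤ τ j) {n : ℕ}
    (X : ℕ → S → S → ℝ) {Xtot Xsup : ℝ} (hX0 : ∀ j k k', 0 ≤ X j k k')
    (hXsup : ∀ i < n, ∀ k k', X (i + 1) k k' ≤ Xsup) (hXtot : ∀ k k', X 0 k k' + ∑ i ∈ range n, X (i + 1) k k' ≤ Xtot)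
    (hXtot0 : 0 ≤ Xtot) (hXsup0 : 0 ≤ Xsup) (δ : ℕ → ℝ) (hneg : 16 * U * ∑ i ∈ range n, δ i ≤ 1)
    (h0 : ∀ k ∈ B, ∀ k' ∈ B, ‖C 0 k k' - (U : ℂ)‖ ≤ ι₀ + X 0 k k')
    (hsteps : ∀ i < n, ∃ w : S → ℝ, (∑ p, |w p| ≤ b) ∧ (∑ p, (|w p| - w p) ≤ δ i) ∧
      ∃ N : Matrix S S ℂ, (1 + Matrix.diagonal (fun p => (w p : ℂ)) * C i) * N = 1 ∧
        ∀ k ∈ B, ∀ k' ∈ B, ‖C (i + 1) k k' - (C i * N) k k'‖ ≤ τ i + X (i + 1) k k')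
    (hsmall : 8 * 42 * ((ι₀ + ∑ j ∈ range n, τ j + Xtot) + (∑ j ∈ range n, τ j + Xsup)) * (b * n) ≤ 1) :
    ∃ u : ℝ, 0 ≤ u ∧ u ≤ 16 / 15 * U ∧ ∀ k ∈ B, ∀ k' ∈ B,
      ‖C n k k' - (u : ℂ)‖ ≤ 12 * ((ι₀ + ∑ j ∈ range n, τ j + Xtot) + (∑ j ∈ range n, τ j + Xsup)) := by
  classical
  -- notation
  set Sτ : ℝ := ∑ j ∈ range n, τ j with hSτ
  have hSτ0 : 0 ≤ Sτ := sum_nonneg fun j _ => hτ0 j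
  have hτle : ∀ i < n, τ i ≤ Sτ := fun i hi =>
    single_le_sum (f := τ) (fun j _ => hτ0 j) (mem_range.2 hi)
  set A : ℝ := ι₀ + Sτ + Xtot with hA
  set R : ℝ := Sτ + Xsup with hR
  have hA0 : 0 ≤ A := by positivity
  -- the step data
  choose! wt hwtabs hwtneg Nm hNm happ using hsteps
  -- the matrices Δ, T and the full-carrier implicit step
  set Δ : ℕ → Matrix S S ℂ := fun i => C (i + 1) - C i * Nm i with hΔ
  set T : ℕ → Matrix S S ℂ :=
    fun i => Δ i + Δ i * Matrix.diagonal (fun p => (wt i p : ℂ)) * C i with hT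
  have hfull : ∀ i < n, C (i + 1) = C i - C (i + 1) * Matrix.diagonal (fun p => (wt i p : ℂ)) * C i + T i :=
    fun i hi => implicit_step_of_rightInverse (wt i) (hNm i hi) (by simp only [hΔ]; abel)
  -- restriction to the ball
  set 𝒞r : ℕ → ↥B → ↥B → ℂ := fun i => resArr B (C i) with h𝒞r
  set wr : ℕ → ↥B → ℝ := fun i u => if i < n then wt i u.1 else 0 with hwr
  set Δr : ℕ → ↥B → ↥B → ℂ := fun i => resArr B (Δ i) with hΔr
  have hwr_eq : ∀ i < n, wr i = fun u : ↥B => wt i u.1 := fun i hi => funext fun u => if_pos hi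
  -- the masses on the ball: ℓ¹ `≤ b`, sign defect `≤ δ`
  have hmr : ∀ i < n, ∑ u, |wr i u| ≤ b := fun i hi => by
    rw [hwr_eq i hi]
    calc ∑ u : ↥B, |wt i u.1| = ∑ u ∈ B, |wt i u| := Finset.sum_coe_sort B (fun u => |wt i u|)
      _ ≤ ∑ u, |wt i u| := sum_le_sum_of_subset_of_nonneg (subset_univ B) fun u _ _ => abs_nonneg _
      _ ≤ b := hwtabs i hi
  have hmr0 : ∀ i, 0 ≤ ∑ u, |wr i u| := fun i => sum_nonneg fun u _ => abs_nonneg _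
  have hνr : ∀ i < n, (∑ u, |wr i u|) - ∑ u, wr i u ≤ δ i := fun i hi => by
    rw [hwr_eq i hi, Finset.sum_coe_sort B (fun u => |wt i u|), Finset.sum_coe_sort B (wt i), ← sum_sub_distrib]
    calc ∑ u ∈ B, (|wt i u| - wt i u) ≤ ∑ u, (|wt i u| - wt i u) :=
          sum_le_sum_of_subset_of_nonneg (subset_univ B) fun u _ _ => sub_nonneg.2 (le_abs_self _)
      _ ≤ δ i := hwtneg i hi
  have hTr_eq : ∀ i < n, resArr B (T i) = Δr i + wmul (wr i) (Δr i) (𝒞r i) := by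
    intro i hi
    funext k k'
    have hw := congrFun (congrFun (resArr_wmul B (wt i) (Δ i) (C i) (hCsupp i)) k) k'
    rw [← hwr_eq i hi] at hw
    simp only [resArr] at hw
    simp only [hT, h𝒞r, hΔr, Pi.add_apply, resArr, Matrix.add_apply, mul_diagonal_mul_apply_eq_wmul, hw]
  have hstepr : ∀ i < n, 𝒞r (i + 1) = 𝒞r i - wmul (wr i) (𝒞r (i + 1)) (𝒞r i) + resArr B (T i) := by
    intro i hi
    funext k k'
    have h := congrFun (congrFun (hfull i hi) k.1) k'.1
    have hw := congrFun (congrFun (resArr_wmul B (wt i) (C (i + 1)) (C i) (hCsupp i)) k) k'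
    rw [← hwr_eq i hi] at hw
    simp only [resArr] at hw
    rw [Matrix.add_apply, Matrix.sub_apply, mul_diagonal_mul_apply_eq_wmul, hw] at h
    simp only [h𝒞r, Pi.add_apply, Pi.sub_apply, resArr]
    exact h
  -- the repulsive scalar cascade on the ball
  obtain ⟨Us, hUs0, hUss⟩ : ∃ Us : ℕ → ℝ, Us 0 = U ∧ ∀ i, Us (i + 1) = Us i / (1 + (∑ u, wr i u) * Us i) :=
    ⟨fun i => Nat.rec U (fun i u => u / (1 + (∑ v, wr i v) * u)) i, rfl, fun i => rfl⟩
  have hUs0' : 0 ≤ Us 0 := by rw [hUs0]; exact hU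
  have hneg' : 16 * Us 0 * ∑ j ∈ range n, ((∑ u, |wr j u|) - ∑ u, wr j u) ≤ 1 := by
    rw [hUs0]
    refine le_trans ?_ hneg
    exact mul_le_mul_of_nonneg_left (sum_le_sum fun j hj => hνr j (mem_range.1 hj)) (by positivity)
  have hUs_nonneg : ∀ i ≤ n, 0 ≤ Us i := fun i hi =>
    (sWaveFloor_bounds (U := Us) (W := fun i => ∑ u, wr i u) (ν := fun i => (∑ u, |wr i u|) - ∑ u, wr i u) hUs0' hUss
      (fun i => show -((∑ u, |wr i u|) - ∑ u, wr i u) ≤ ∑ u, wr i u by linarith [hmr0 i])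
      (fun i => sub_nonneg.2 (sum_le_sum_abs (wr i))) hneg' i hi).1
  -- the split of the tail: core + column source
  set 𝒟r : ℕ → ↥B → ↥B → ℂ := fun i => 𝒞r i - ((Us i : ℝ) : ℂ) • onesArr with h𝒟r
  set Er : ℕ → ↥B → ↥B → ℂ := fun i => Δr i + wmul (wr i) (Δr i) (𝒟r i) with hEr
  set cr : ℕ → ↥B → ℂ := fun i s => ((Us i : ℝ) : ℂ) * ∑ u, Δr i s u * (wr i u : ℂ) with hcr
  have hsplit : ∀ i < n, resArr B (T i) = Er i + fun s _ => cr i s := by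
    intro i hi
    rw [hTr_eq i hi]
    have h𝒞 : 𝒞r i = ((Us i : ℝ) : ℂ) • onesArr + 𝒟r i := by simp only [h𝒟r]; abel
    funext s t
    simp only [hEr, hcr, Pi.add_apply]
    conv_lhs => rw [h𝒞]
    rw [wmul_add_right, wmul_smul_right]
    simp only [Pi.add_apply, Pi.smul_apply, smul_eq_mul, wmul_onesArr_right_eq]
    ring
  have hstep' : ∀ i < n, 𝒞r (i + 1) = 𝒞r i - wmul (wr i) (𝒞r (i + 1)) (𝒞r i) + (Er i + fun s _ => cr i s) := by
    intro i hi
    have h := hstepr i hi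
    rw [hsplit i hi] at h
    exact h
  -- the entrywise majorant of the remainder
  set e : ℕ → ↥B → ↥B → ℝ := fun i s t => τ i + X (i + 1) s.1 t.1 with he
  have he0 : ∀ i s t, 0 ≤ e i s t := fun i s t => add_nonneg (hτ0 i) (hX0 _ _ _)
  have hΔr_le : ∀ i < n, ∀ s t : ↥B, ‖Δr i s t‖ ≤ e i s t := by
    intro i hi s t
    have := happ i hi s.1 s.2 t.1 t.2
    simpa [hΔr, hΔ, resArr, Matrix.sub_apply, he] using this
  have he_le_R : ∀ i < n, ∀ s t : ↥B, e i s t ≤ R := by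
    intro i hi s t
    have h1 := hτle i hi
    have h2 := hXsup i hi s.1 t.1
    simp only [he, hR] at *
    linarith
  have hR0 : 0 ≤ R := by positivity
  have hΔr_sup : ∀ i < n, esup (Δr i) ≤ R := fun i hi =>
    esup_le (fun s t => (hΔr_le i hi s t).trans (he_le_R i hi s t)) hR0
  -- hypotheses of the cascade lemma
  have hE : ∀ i < n, ∀ s t, ‖Er i s t‖ ≤ e i s t + R * (∑ u, |wr i u|) * esup (𝒞r i - ((Us i : ℝ) : ℂ) • onesArr) := by
    intro i hi s t
    have h1 := hΔr_le i hi s t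
    have h2 : ‖wmul (wr i) (Δr i) (𝒟r i) s t‖ ≤ esup (Δr i) * (∑ u, |wr i u|) * esup (𝒟r i) :=
      (le_esup _ s t).trans (esup_wmul_le_abs (wr i) _ _)
    have h3 : esup (Δr i) * (∑ u, |wr i u|) * esup (𝒟r i) ≤ R * (∑ u, |wr i u|) * esup (𝒟r i) :=
      mul_le_mul_of_nonneg_right (mul_le_mul_of_nonneg_right (hΔr_sup i hi) (hmr0 i)) (esup_nonneg _)
    calc ‖Er i s t‖ = ‖Δr i s t + wmul (wr i) (Δr i) (𝒟r i) s t‖ := rfl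
      _ ≤ ‖Δr i s t‖ + ‖wmul (wr i) (Δr i) (𝒟r i) s t‖ := norm_add_le _ _
      _ ≤ e i s t + R * (∑ u, |wr i u|) * esup (𝒟r i) := by linarith
  have hc : ∀ i < n, ∀ s, ‖cr i s‖ ≤ Us i * (∑ u, |wr i u|) * R := by
    intro i hi s
    have h1 : ‖∑ u, Δr i s u * (wr i u : ℂ)‖ ≤ (∑ u, |wr i u|) * esup (Δr i) :=
      norm_sum_mul_le_abs fun u => le_esup (Δr i) s u
    calc ‖cr i s‖ = Us i * ‖∑ u, Δr i s u * (wr i u : ℂ)‖ := by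
          simp only [hcr, norm_mul, Complex.norm_real, Real.norm_eq_abs, abs_of_nonneg (hUs_nonneg i hi.le)]
      _ ≤ Us i * ((∑ u, |wr i u|) * R) :=
          mul_le_mul_of_nonneg_left (h1.trans (mul_le_mul_of_nonneg_left (hΔr_sup i hi) (hmr0 i))) (hUs_nonneg i hi.le)
      _ = Us i * (∑ u, |wr i u|) * R := by ring
  have ha : ∀ s t : ↥B, ‖𝒞r 0 s t - ((Us 0 : ℝ) : ℂ)‖ + ∑ j ∈ range n, e j s t ≤ A := by
    intro s t
    have h0' : ‖𝒞r 0 s t - ((Us 0 : ℝ) : ℂ)‖ ≤ ι₀ + X 0 s.1 t.1 := by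
      rw [hUs0]
      have := h0 s.1 s.2 t.1 t.2
      simpa [h𝒞r, resArr] using this
    have h1 : ∑ j ∈ range n, e j s t = Sτ + ∑ j ∈ range n, X (j + 1) s.1 t.1 := by
      simp only [he, hSτ, sum_add_distrib]
    have h2 := hXtot s.1 t.1
    rw [h1, hA]
    linarith
  have hsmall' : 8 * 42 * (A + R) * ∑ j ∈ range n, (∑ u, |wr j u|) ≤ 1 := by
    refine le_trans ?_ hsmall
    have hW : ∑ j ∈ range n, (∑ u, |wr j u|) ≤ b * n := by
      calc ∑ j ∈ range n, (∑ u, |wr j u|) ≤ ∑ j ∈ range n, b := sum_le_sum fun j hj => hmr j (mem_range.1 hj)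
        _ = b * n := by rw [sum_const, card_range, nsmul_eq_mul, mul_comm]
    have : 8 * 42 * (A + R) * ∑ j ∈ range n, (∑ u, |wr j u|) ≤ 8 * 42 * (A + R) * (b * n) :=
      mul_le_mul_of_nonneg_left hW (by positivity)
    refine this.trans (le_of_eq ?_)
    simp only [hA, hR, hSτ]
  -- the cascade lemma
  have hmain := sWaveCascade_envelope_edge (w := wr) (𝒞 := 𝒞r) (E := Er) (c := cr) (e := e) (U := Us) (N := n)
    (a := A) (r := R) hUs0' hUss hstep' he0 hE hA0 ha hR0 hc hneg' hsmall'
  obtain ⟨⟨hUn0, hUnU⟩, hdev⟩ := hmain n le_rfl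
  refine ⟨Us n, hUn0, by rw [hUs0] at hUnU; exact hUnU, fun k hk k' hk' => ?_⟩
  have hent := le_esup (𝒞r n - ((Us n : ℝ) : ℂ) • onesArr) ⟨k, hk⟩ ⟨k', hk'⟩
  have heq : (𝒞r n - ((Us n : ℝ) : ℂ) • onesArr : ↥B → ↥B → ℂ) ⟨k, hk⟩ ⟨k', hk'⟩ = C n k k' - ((Us n : ℝ) : ℂ) := by
    simp only [Pi.sub_apply, Pi.smul_apply, smul_eq_mul, onesArr, mul_one, h𝒞r, resArr]
  rw [heq] at hent
  refine hent.trans (hdev.trans (le_of_eq ?_))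
  simp only [hA, hR, hSτ]

/-! ## The same for an AMPLITUDE family read on the ball through its truncated array

This is the shape in which every value carrier of the route enters: `klPairArray … i Qm = Matrix.of (fun k k' => if k ∈ klBall ∧ k' ∈ klBall then
klPairAmplitude … i Qm k k' else 0)` (`…SplitPredicatesV2`), and likewise for any other carrier (e.g. the Wick-ordered amplitudes of
`…KLRegimeWickOrderedStep`).  So an instance is obtained by unfolding the carrier's array (`rfl`). -/

omit [Fintype S] in
/-- Entries of a ball-truncated array on the ball. -/
theorem truncArr_apply_of_mem (B : Finset S) (𝒜 : S → S → ℂ) {k k' : S} (hk : k ∈ B) (hk' : k' ∈ B) :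
    (Matrix.of fun s t => if s ∈ B ∧ t ∈ B then 𝒜 s t else 0) k k' = 𝒜 k k' := by
  simp [hk, hk']

omit [Fintype S] in
/-- A ball-truncated array vanishes off the ball (first index). -/
theorem truncArr_apply_of_not_mem (B : Finset S) (𝒜 : S → S → ℂ) {k : S} (hk : k ∉ B) (k' : S) :
    (Matrix.of fun s t => if s ∈ B ∧ t ∈ B then 𝒜 s t else 0) k k' = 0 := by
  simp [hk]

/-- **Row 0′, in-class ladder part, for an arbitrary AMPLITUDE family `𝒜 : ℕ → S → S → ℂ` read on the ball `B`**, the ladder steps being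
stated — as in the bundle's (E2-v8) clause — with right inverses of `1 + diag(w_i)·[𝒜 i]_B`, `[𝒜 i]_B := Matrix.of (fun s t => if s ∈ B ∧ t ∈ B
then 𝒜 i s t else 0)` the ball-truncated array, and the entrywise bound `‖𝒜 (i+1) k k' − ([𝒜 i]_B · N_i) k k'‖ ≤ τ_i + X_{i+1}(k,k')` on `B × B`.
Conclusion: `∃ u ∈ [0, (16/15)·U]`, `‖𝒜 n k k' − u‖ ≤ 12·((ι₀ + Στ + Xtot) + (Στ + Xsup))` on `B × B`.  (`pairLadder_envelope_edge` is the
instance `S := TorusSite 2 L`, `B := klBall L μ K`, `𝒜 i := klPairAmplitude L M β U μ K i Qm` — so `[𝒜 i]_B = klPairArray … i Qm` by `rfl` —,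
`τ i := drivePBar … i + eremBar … i`, `ι₀ := initDevBar G U`, `b := G.bhi`.) -/
theorem amplitudeLadder_envelope_edge (B : Finset S) (𝒜 : ℕ → S → S → ℂ)
    {U b ι₀ : ℝ} (hU : 0 ≤ U) (hι₀ : 0 ≤ ι₀) (τ : ℕ → ℝ) (hτ0 : ∀ j, 0 ≤ τ j) {n : ℕ}
    (X : ℕ → S → S → ℝ) {Xtot Xsup : ℝ} (hX0 : ∀ j k k', 0 ≤ X j k k')
    (hXsup : ∀ i < n, ∀ k k', X (i + 1) k k' ≤ Xsup) (hXtot : ∀ k k', X 0 k k' + ∑ i ∈ range n, X (i + 1) k k' ≤ Xtot)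
    (hXtot0 : 0 ≤ Xtot) (hXsup0 : 0 ≤ Xsup) (δ : ℕ → ℝ) (hneg : 16 * U * ∑ i ∈ range n, δ i ≤ 1)
    (h0 : ∀ k ∈ B, ∀ k' ∈ B, ‖𝒜 0 k k' - (U : ℂ)‖ ≤ ι₀ + X 0 k k')
    (hsteps : ∀ i < n, ∃ w : S → ℝ, (∑ p, |w p| ≤ b) ∧ (∑ p, (|w p| - w p) ≤ δ i) ∧
      ∃ N : Matrix S S ℂ,
        (1 + Matrix.diagonal (fun p => (w p : ℂ)) * Matrix.of (fun s t => if s ∈ B ∧ t ∈ B then 𝒜 i s t else 0)) * N = 1 ∧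
        ∀ k ∈ B, ∀ k' ∈ B,
          ‖𝒜 (i + 1) k k' - (Matrix.of (fun s t => if s ∈ B ∧ t ∈ B then 𝒜 i s t else 0) * N) k k'‖ ≤ τ i + X (i + 1) k k')
    (hsmall : 8 * 42 * ((ι₀ + ∑ j ∈ range n, τ j + Xtot) + (∑ j ∈ range n, τ j + Xsup)) * (b * n) ≤ 1) :
    ∃ u : ℝ, 0 ≤ u ∧ u ≤ 16 / 15 * U ∧ ∀ k ∈ B, ∀ k' ∈ B,
      ‖𝒜 n k k' - (u : ℂ)‖ ≤ 12 * ((ι₀ + ∑ j ∈ range n, τ j + Xtot) + (∑ j ∈ range n, τ j + Xsup)) := by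
  have h := matrixLadder_envelope_edge B (fun i => Matrix.of fun s t => if s ∈ B ∧ t ∈ B then 𝒜 i s t else 0)
    (fun i u hu t => truncArr_apply_of_not_mem B (𝒜 i) hu t)
    hU hι₀ τ hτ0 X hX0 hXsup hXtot hXtot0 hXsup0 δ hneg
    (fun k hk k' hk' => by rw [truncArr_apply_of_mem B (𝒜 0) hk hk']; exact h0 k hk k' hk')
    (fun i hi => by
      obtain ⟨w, hwabs, hwneg, N, hN, hb⟩ := hsteps i hi
      exact ⟨w, hwabs, hwneg, N, hN, fun k hk k' hk' => by
        rw [truncArr_apply_of_mem B (𝒜 (i + 1)) hk hk']; exact hb k hk k' hk'⟩)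
    hsmall
  obtain ⟨u, hu0, huU, hdev⟩ := h
  exact ⟨u, hu0, huU, fun k hk k' hk' => by rw [← truncArr_apply_of_mem B (𝒜 n) hk hk']; exact hdev k hk k' hk'⟩

end Summit.HubbardSuperconductivity.HubbardSuperconductivity.Theorems.SWaveCascade

end
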